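import Literature.NumberTheory.Rogawski1990.ArchCentralLimitChamberReduction   -- ★ p843009 (this seat): `ArchCentralLimitFormulaRankTwo.of_chamberExtensions`, `isOpen_chamber`, line jets `…_of_contDiffOn`
import Literature.NumberTheory.Rogawski1990.ArchCentralLimitCornerRegularity  -- ★ p843483 (this seat): the (A6) named row `ArchCentralLimitCornerRegularity` — ED. 2
import HarnessLib

/-!
# CORNER JETS ARE INTRINSIC: two `C³` corner extensions of `F|_{C_σ}` have the same 3-jet at the corner — so the VALUE socket of the N1 skeleton decouples from the EXISTENCE socket (A6)
# (Rogawski 1990 §8.4 p. 126 → Harish-Chandra [H₂] L. 17.5; Orloff 1987 p. 198 «the normalized orbital integral is smooth on the closure of any connected component of J′»)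

Topic `NumberTheory/Rogawski1990`; namespace `Literature.NumberTheory.Rogawski1990` (§1 generic in `Literature.Analysis.Calculus`).  THEOREMS ONLY (no `def`, no instance, no notation,
no axiom, no named fact, no `sorry`).  Cell `pub/hodgecm-mathlib`, ENGINE T1 (crux H413 = `stmt-HodgeConjecture-24833`); ROAD-Sd, «SdArch» ED. 3's ONE open stub N1 = `stub_ArchCentralLimitU21`
(ROAD A, owner F0P3a-p05 (g13)); the N1 ASSEMBLY SKELETON (α1) ∕ (A6)-statement (LEAD F0P3a-plan (g10) T9-8 (D), T9-12 (3)(a)), F0P3a-p02 (g12), 2026-09-01.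

WHY.  ★ `ArchCentralLimitFormulaRankTwo.of_chamberExtensions` asks, per chamber `C_σ`, for ONE package «open `U ∋ 0`, `H` of class `C³` on `U` agreeing with `F_Θ∘chart` on `U ∩ C_σ`, AND
`Λ₈^∠[H](0) = −(c·i)·Θ(ζ•1)`».  The EXISTENCE of `H` is Harish-Chandra's boundary regularity of the invariant integral at the corner («(A6)», a printed theorem the cell books as a row);
the VALUE is what ROAD A computes ((A4) along the compact wall, (h4) across the noncompact walls).  For the two to be supplied by DIFFERENT hands the value must not depend on WHICH extension:
§1 **`iteratedFDeriv_eq_of_contDiffOn_of_eqOn_inter`** — if `f, g` are `Cⁿ` on an open `U ∋ x` and agree on `U ∩ C` with `C` open and `x ∈ closure C`, then `Dᵐf(x) = Dᵐg(x)` for `m ≤ n`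
(the jets agree on the open set `U ∩ C` — `Filter.EventuallyEq.iteratedFDeriv` — and are continuous at `x ∈ closure (U ∩ C)`); §2 the corner `0` lies in the closure of every chamber (the ray
`t ↦ t·(δ_{σ2} − δ_{σ0})`); §3 **`lambda8Angle_zero_eq_of_cornerExtensions`** — two corner extensions `(U₁, H₁)`, `(U₂, H₂)` of the SAME `Fz∘chart|_{C_σ}` have the same 8-ray corner value
`Λ₈^∠[H₁](0) = Λ₈^∠[H₂](0)` (line jets are `D³H(0)[v,v,v]`, ★ `iteratedDeriv_line_eq_iteratedFDeriv_of_contDiffOn`); §4 **`ArchCentralLimitFormulaRankTwo.of_cornerRegularity_of_values`** —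
THE LETTER from (A6) «every chamber has SOME `C³` corner extension» (stated inline, in the socket's tokens; = the named row `ArchCentralLimitCornerRegularity` filed separately, definition lane)
plus the VALUE THEOREM «EVERY `C³` corner extension has `Λ₈^∠[H](0) = −(c·i)·Θ(ζ•1)`» (∀-form; by §3 it suffices to know it for one).
HONEST LABEL: HC_CM is proved only modulo the printed citations until rung 0 closes; this file is bookkeeping around the printed-hard letter N1 and pays nothing by itself.

## References
* [Rogawski1990] J. D. Rogawski, *Automorphic Representations of Unitary Groups in Three Variables*, Ann. of Math. Stud. 123 (1990), §8.4 pp. 126–127.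
* [HarishChandra1975HARRG1] Harish-Chandra, *Harmonic analysis on real reductive groups I*, J. Funct. Anal. 19 (1975), §17, Lemma 17.5 (Rogawski's [H₂]).
* [Orloff1987OrbitalIntegrals] J. Orloff, *Orbital integrals on symmetric spaces*, LNM 1243 (1987), Introduction p. 198.
* [HormanderALPDO1] L. Hörmander, *The Analysis of Linear Partial Differential Operators I*, 2nd ed. (1990), Thm. 1.1.9.
-/

set_option autoImplicit false

noncomputable section

open Filter Topology Set Function

/-! ## §1 Jets on an open set are determined by the values on an open subset whose closure contains the point -/

namespace Literature.Analysis.Calculus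

variable {E F : Type*} [NormedAddCommGroup E] [NormedSpace ℝ E] [NormedAddCommGroup F] [NormedSpace ℝ F]

/-- **Jets are intrinsic to a corner**: if `f` and `g` are `Cⁿ` on the open set `U ∋ x` and agree on `U ∩ C`, where `C` is open and `x ∈ closure C`, then `Dᵐf(x) = Dᵐg(x)` for every `m ≤ n` —
the two jets agree on the open set `U ∩ C` (Mathlib `Filter.EventuallyEq.iteratedFDeriv`) and are continuous at `x`, which lies in the closure of `U ∩ C`. [cite: HormanderALPDO1, Thm. 1.1.9] -/
theorem iteratedFDeriv_eq_of_contDiffOn_of_eqOn_inter {f g : E → F} {U C : Set E} (hU : IsOpen U) (hC : IsOpen C) {x : E} (hxU : x ∈ U) (hxC : x ∈ closure C)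
    {n : ℕ} (hf : ContDiffOn ℝ n f U) (hg : ContDiffOn ℝ n g U) (hfg : ∀ y ∈ U ∩ C, f y = g y) {m : ℕ} (hm : m ≤ n) :
    iteratedFDeriv ℝ m f x = iteratedFDeriv ℝ m g x := by
  have hxcl : x ∈ closure (U ∩ C) := hU.inter_closure ⟨hxU, hxC⟩
  haveI : (𝓝[U ∩ C] x).NeBot := mem_closure_iff_nhdsWithin_neBot.1 hxcl
  have hfc : ContinuousAt (iteratedFDeriv ℝ m f) x := (hf.contDiffAt (hU.mem_nhds hxU)).continuousAt_iteratedFDeriv (by exact_mod_cast hm)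
  have hgc : ContinuousAt (iteratedFDeriv ℝ m g) x := (hg.contDiffAt (hU.mem_nhds hxU)).continuousAt_iteratedFDeriv (by exact_mod_cast hm)
  have heq : ∀ y ∈ U ∩ C, iteratedFDeriv ℝ m f y = iteratedFDeriv ℝ m g y := by
    intro y hy
    have hev : f =ᶠ[𝓝 y] g := by
      filter_upwards [(hU.inter hC).mem_nhds hy] with z hz
      exact hfg z hz
    exact (hev.iteratedFDeriv ℝ m).eq_of_nhds
  have h1 : Tendsto (iteratedFDeriv ℝ m f) (𝓝[U ∩ C] x) (𝓝 (iteratedFDeriv ℝ m f x)) := hfc.tendsto.mono_left nhdsWithin_le_nhds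
  have h2 : Tendsto (iteratedFDeriv ℝ m f) (𝓝[U ∩ C] x) (𝓝 (iteratedFDeriv ℝ m g x)) :=
    (hgc.tendsto.mono_left nhdsWithin_le_nhds).congr' (eventually_nhdsWithin_of_forall fun y hy => (heq y hy).symm)
  exact tendsto_nhds_unique h1 h2

end Literature.Analysis.Calculus

namespace Literature.NumberTheory.Rogawski1990

open Literature.Analysis.Calculus Literature.NumberTheory.Automorphic Literature.NumberTheory.Automorphic.UnitaryGroup
open MeasureTheory Measure NumberField NumberField.InfinitePlace
open scoped Matrix MatrixGroups Matrix.Norms.Operator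

/-! ## §2 The corner lies in the closure of every chamber -/

section Chamber

/-- **`0 ∈ closure C_σ`**: the ray `t ↦ t·(δ_{σ2} − δ_{σ0})`, `t > 0`, lies in the chamber `C_σ` and tends to the corner. [cite: Rogawski1990, §8.4 p. 126] -/
theorem zero_mem_closure_chamber (σ : Equiv.Perm (Fin 3)) : (0 : Fin 3 → ℝ) ∈ closure {θ : Fin 3 → ℝ | θ (σ 0) < θ (σ 1) ∧ θ (σ 1) < θ (σ 2)} := by
  have hc : Continuous fun t : ℝ => t • ((Pi.single (σ 2) (1 : ℝ) : Fin 3 → ℝ) - Pi.single (σ 0) (1 : ℝ)) :=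
    continuous_id.smul continuous_const
  have h0 : (0 : ℝ) • ((Pi.single (σ 2) (1 : ℝ) : Fin 3 → ℝ) - Pi.single (σ 0) (1 : ℝ)) = 0 := zero_smul _ _
  have ht : Tendsto (fun t : ℝ => t • ((Pi.single (σ 2) (1 : ℝ) : Fin 3 → ℝ) - Pi.single (σ 0) (1 : ℝ))) (𝓝[>] (0 : ℝ)) (𝓝 0) := by
    have := (hc.tendsto 0).mono_left (nhdsWithin_le_nhds (s := Ioi (0 : ℝ)))
    rwa [h0] at this
  refine mem_closure_of_tendsto ht ?_
  filter_upwards [self_mem_nhdsWithin] with t ht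
  have ht' : (0 : ℝ) < t := ht
  have h20 : σ 2 ≠ σ 0 := fun h => absurd (σ.injective h) (by decide)
  have h10 : σ 1 ≠ σ 0 := fun h => absurd (σ.injective h) (by decide)
  have h12 : σ 1 ≠ σ 2 := fun h => absurd (σ.injective h) (by decide)
  simp only [Pi.smul_apply, Pi.sub_apply, smul_eq_mul, Pi.single_eq_same, Pi.single_eq_of_ne h20.symm, Pi.single_eq_of_ne h10,
    Pi.single_eq_of_ne h12, Pi.single_eq_of_ne h20]
  constructor <;> linarith

end Chamber

/-! ## §3 Two `C³` corner extensions of the same chamber function have the same 8-ray corner value -/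

section CornerJet

/-- **CORNER JETS OF `Fz ∘ chart|_{C_σ}` ARE INTRINSIC**: if `(U₁, H₁)` and `(U₂, H₂)` are two `C³` corner extensions of the same torus function `Fz` on the chamber `C_σ` (open `U_i ∋ 0`,
`ContDiffOn ℝ 3 H_i U_i`, `H_i = Fz∘chart` on `U_i ∩ C_σ`), then `Λ₈^∠[H₁](0) = Λ₈^∠[H₂](0)` — every line jet `(d∕ds)³|₀ H_i(s·v) = D³H_i(0)[v,v,v]` (★ `iteratedDeriv_line_eq_iteratedFDeriv_of_contDiffOn`)
and `D³H₁(0) = D³H₂(0)` by §1 on `U₁ ∩ U₂` (§2: `0 ∈ closure C_σ`).  Hence the VALUE socket of ★ `of_chamberExtensions` may be stated for ANY corner extension. [cite: Rogawski1990, §8.4 p. 126] -/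
theorem lambda8Angle_zero_eq_of_cornerExtensions (Fz : (Fin 3 → Circle) → ℂ) (ζ : Circle) (σ : Equiv.Perm (Fin 3))
    {U₁ U₂ : Set (Fin 3 → ℝ)} (hU₁ : IsOpen U₁) (h0₁ : (0 : Fin 3 → ℝ) ∈ U₁) (hU₂ : IsOpen U₂) (h0₂ : (0 : Fin 3 → ℝ) ∈ U₂)
    {H₁ H₂ : (Fin 3 → ℝ) → ℂ} (hH₁ : ContDiffOn ℝ 3 H₁ U₁) (hH₂ : ContDiffOn ℝ 3 H₂ U₂)
    (hF₁ : ∀ θ ∈ U₁, θ (σ 0) < θ (σ 1) ∧ θ (σ 1) < θ (σ 2) → H₁ θ = Fz (fun k : Fin 3 => ζ * Circle.exp (θ k)))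
    (hF₂ : ∀ θ ∈ U₂, θ (σ 0) < θ (σ 1) ∧ θ (σ 1) < θ (σ 2) → H₂ θ = Fz (fun k : Fin 3 => ζ * Circle.exp (θ k))) :
    (1 / 48 : ℂ) * ∑ ε : Fin 3 → Bool, ((((if ε 0 then (1 : ℝ) else -1) * (if ε 1 then (1 : ℝ) else -1) * (if ε 2 then (1 : ℝ) else -1) : ℝ)) : ℂ) *
          iteratedDeriv 3 (fun s : ℝ => H₁ (s • ![(if ε 0 then (1 : ℝ) else -1) + (if ε 1 then (1 : ℝ) else -1), -(if ε 0 then (1 : ℝ) else -1) + (if ε 2 then (1 : ℝ) else -1), -(if ε 1 then (1 : ℝ) else -1) - (if ε 2 then (1 : ℝ) else -1)])) 0 =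
      (1 / 48 : ℂ) * ∑ ε : Fin 3 → Bool, ((((if ε 0 then (1 : ℝ) else -1) * (if ε 1 then (1 : ℝ) else -1) * (if ε 2 then (1 : ℝ) else -1) : ℝ)) : ℂ) *
          iteratedDeriv 3 (fun s : ℝ => H₂ (s • ![(if ε 0 then (1 : ℝ) else -1) + (if ε 1 then (1 : ℝ) else -1), -(if ε 0 then (1 : ℝ) else -1) + (if ε 2 then (1 : ℝ) else -1), -(if ε 1 then (1 : ℝ) else -1) - (if ε 2 then (1 : ℝ) else -1)])) 0 := by
  have hU : IsOpen (U₁ ∩ U₂) := hU₁.inter hU₂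
  have hjet : iteratedFDeriv ℝ 3 H₁ 0 = iteratedFDeriv ℝ 3 H₂ 0 :=
    iteratedFDeriv_eq_of_contDiffOn_of_eqOn_inter hU (isOpen_chamber σ) ⟨h0₁, h0₂⟩ (zero_mem_closure_chamber σ)
      (hH₁.mono inter_subset_left) (hH₂.mono inter_subset_right)
      (fun θ hθ => by rw [hF₁ θ hθ.1.1 hθ.2, hF₂ θ hθ.1.2 hθ.2]) le_rfl
  refine congrArg (fun t : ℂ => (1 / 48 : ℂ) * t) (Finset.sum_congr rfl fun ε _ => ?_)
  refine congrArg (fun t : ℂ => ((((if ε 0 then (1 : ℝ) else -1) * (if ε 1 then (1 : ℝ) else -1) * (if ε 2 then (1 : ℝ) else -1) : ℝ)) : ℂ) * t) ?_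
  have h₁ := iteratedDeriv_line_eq_iteratedFDeriv_of_contDiffOn hU₁ hH₁ (![(if ε 0 then (1 : ℝ) else -1) + (if ε 1 then (1 : ℝ) else -1), -(if ε 0 then (1 : ℝ) else -1) + (if ε 2 then (1 : ℝ) else -1), -(if ε 1 then (1 : ℝ) else -1) - (if ε 2 then (1 : ℝ) else -1)]) (0 : Fin 3 → ℝ) (t := 0) (by simpa using h0₁) (k := 3) le_rfl
  have h₂ := iteratedDeriv_line_eq_iteratedFDeriv_of_contDiffOn hU₂ hH₂ (![(if ε 0 then (1 : ℝ) else -1) + (if ε 1 then (1 : ℝ) else -1), -(if ε 0 then (1 : ℝ) else -1) + (if ε 2 then (1 : ℝ) else -1), -(if ε 1 then (1 : ℝ) else -1) - (if ε 2 then (1 : ℝ) else -1)]) (0 : Fin 3 → ℝ) (t := 0) (by simpa using h0₂) (k := 3) le_rfl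
  simp only [add_zero, zero_smul] at h₁ h₂
  rw [h₁, h₂, hjet]

end CornerJet

/-! ## §4 THE LETTER from (A6) «corner regularity» (∃ some extension) and the VALUE THEOREM (∀ extensions) -/

section Letter

variable {L : Type} [Field L] {α : Fin 3 → L} {w : {w : InfinitePlace L // IsComplex w}}

/-- **`ArchCentralLimitFormulaRankTwo` FROM CORNER REGULARITY AND THE VALUE THEOREM.**  (A6) `hreg`: for every Borel structure, under the frame guards, for every Haar right-invariant `ν`,
every ambient smooth `Θ` compactly supported on `G_w`, every `ζ ∈ S¹` and every chamber `σ`, SOME `C³` corner extension `(U, H)` of `F_Θ∘chart|_{C_σ}` exists (`F_Θ = ρ′Δ·Φ_Θ` in the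
letter's tokens) — Harish-Chandra's boundary regularity of the invariant integral («smooth on the closure of any connected component of the regular set»), the printed row; (VAL) `hval`:
there is `c > 0` (per `ν`) such that EVERY such corner extension has `Λ₈^∠[H](0) = −(c·i)·Θ(diag(ζ,ζ,ζ))` — the ROAD A value theorem ((A4) along the compact wall, (h4) across the noncompact
walls; by §3 one extension per chamber suffices).  THEN the (L_{U(2,1)}) letter holds (★ `of_chamberExtensions`). [cite: Rogawski1990, §8.4 pp. 126–127]
[cite: HarishChandra1975HARRG1, §17 Lemma 17.5] [cite: Orloff1987OrbitalIntegrals, Introduction p. 198] -/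
theorem ArchCentralLimitFormulaRankTwo.of_cornerRegularity_of_values
    (hreg : ∀ [MeasurableSpace (archLocal L 3 (Matrix.diagonal α) w)] [BorelSpace (archLocal L 3 (Matrix.diagonal α) w)],
      (∀ i, α i ≠ 0) → (∀ i, (w.1.embedding (α i)).im = 0) →
      ∀ (ν : MeasureTheory.Measure (archLocal L 3 (Matrix.diagonal α) w)) [ν.IsHaarMeasure] [ν.IsMulRightInvariant]
        (Θ : Matrix (Fin 3) (Fin 3) ℂ → ℂ), ContDiff ℝ (⊤ : ℕ∞) Θ →
          HasCompactSupport (fun k : archLocal L 3 (Matrix.diagonal α) w => Θ ((k : GL (Fin 3) ℂ) : Matrix (Fin 3) (Fin 3) ℂ)) →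
          ∀ (ζ : Circle) (σ : Equiv.Perm (Fin 3)),
            ∃ (U : Set (Fin 3 → ℝ)) (H : (Fin 3 → ℝ) → ℂ), IsOpen U ∧ (0 : Fin 3 → ℝ) ∈ U ∧ ContDiffOn ℝ 3 H U ∧
              ∀ θ ∈ U, θ (σ 0) < θ (σ 1) ∧ θ (σ 1) < θ (σ 2) →
                H θ = ((((ζ * Circle.exp (θ 0) : Circle) : ℂ)) * (((ζ * Circle.exp (θ 2) : Circle) : ℂ))⁻¹) * ((1 - (((ζ * Circle.exp (θ 1) : Circle) : ℂ)) * (((ζ * Circle.exp (θ 0) : Circle) : ℂ))⁻¹) * (1 - (((ζ * Circle.exp (θ 2) : Circle) : ℂ)) * (((ζ * Circle.exp (θ 1) : Circle) : ℂ))⁻¹) * (1 - (((ζ * Circle.exp (θ 2) : Circle) : ℂ)) * (((ζ * Circle.exp (θ 0) : Circle) : ℂ))⁻¹)) * (∫ g, Θ (((g * ⟨circleDiagonal 3 (fun k => ζ * Circle.exp (θ k)), circleDiagonal_mem_archLocal_diagonal L 3 α w _⟩ * g⁻¹ : archLocal L 3 (Matrix.diagonal α) w) : GL (Fin 3) ℂ)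 : Matrix (Fin 3) (Fin 3) ℂ) ∂ν))
    (hval : ∀ [MeasurableSpace (archLocal L 3 (Matrix.diagonal α) w)] [BorelSpace (archLocal L 3 (Matrix.diagonal α) w)],
      (∀ i, α i ≠ 0) → (∀ i, (w.1.embedding (α i)).im = 0) →
      (∃ i j : Fin 3, (w.1.embedding (α i)).re * (w.1.embedding (α j)).re < 0) →
      ∀ (ν : MeasureTheory.Measure (archLocal L 3 (Matrix.diagonal α) w)) [ν.IsHaarMeasure] [ν.IsMulRightInvariant],
      ∃ c : ℝ, 0 < c ∧
        ∀ (Θ : Matrix (Fin 3) (Fin 3) ℂ → ℂ), ContDiff ℝ (⊤ : ℕ∞) Θ →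
          HasCompactSupport (fun k : archLocal L 3 (Matrix.diagonal α) w => Θ ((k : GL (Fin 3) ℂ) : Matrix (Fin 3) (Fin 3) ℂ)) →
          ∀ (ζ : Circle) (σ : Equiv.Perm (Fin 3)) (U : Set (Fin 3 → ℝ)) (H : (Fin 3 → ℝ) → ℂ), IsOpen U → (0 : Fin 3 → ℝ) ∈ U → ContDiffOn ℝ 3 H U →
            (∀ θ ∈ U, θ (σ 0) < θ (σ 1) ∧ θ (σ 1) < θ (σ 2) →
              H θ = ((((ζ * Circle.exp (θ 0) : Circle) : ℂ)) * (((ζ * Circle.exp (θ 2) : Circle) : ℂ))⁻¹) * ((1 - (((ζ * Circle.exp (θ 1) : Circle) : ℂ)) * (((ζ * Circle.exp (θ 0) : Circle) : ℂ))⁻¹) * (1 - (((ζ * Circle.exp (θ 2) : Circle) : ℂ)) * (((ζ * Circle.exp (θ 1) : Circle) : ℂ))⁻¹) * (1 - (((ζ * Circle.exp (θ 2) : Circle) : ℂ)) * (((ζ * Circle.exp (θ 0) : Circle) : ℂ))⁻¹)) * (∫ g, Θ (((g * ⟨circleDiagonal 3 (fun k => ζ * Circle.exp (θ k)), circleDiagonal_mem_archLocal_diagonal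 L 3 α w _⟩ * g⁻¹ : archLocal L 3 (Matrix.diagonal α) w) : GL (Fin 3) ℂ) : Matrix (Fin 3) (Fin 3) ℂ) ∂ν)) →
            (1 / 48 : ℂ) * ∑ ε : Fin 3 → Bool, ((((if ε 0 then (1 : ℝ) else -1) * (if ε 1 then (1 : ℝ) else -1) * (if ε 2 then (1 : ℝ) else -1) : ℝ)) : ℂ) *
          iteratedDeriv 3 (fun s : ℝ => H (s • ![(if ε 0 then (1 : ℝ) else -1) + (if ε 1 then (1 : ℝ) else -1), -(if ε 0 then (1 : ℝ) else -1) + (if ε 2 then (1 : ℝ) else -1), -(if ε 1 then (1 : ℝ) else -1) - (if ε 2 then (1 : ℝ) else -1)])) 0 =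
              -((c : ℂ) * Complex.I) * Θ ((circleDiagonal 3 (fun _ => ζ) : GL (Fin 3) ℂ) : Matrix (Fin 3) (Fin 3) ℂ)) :
    ArchCentralLimitFormulaRankTwo L α w := by
  refine ArchCentralLimitFormulaRankTwo.of_chamberExtensions fun hα hreal hind ν => ?_
  intro _ _
  obtain ⟨c, hc, hv⟩ := hval hα hreal hind ν
  refine ⟨c, hc, fun Θ hΘ hΘc ζ σ => ?_⟩
  obtain ⟨U, H, hUo, h0U, hH, hHF⟩ := hreg hα hreal ν Θ hΘ hΘc ζ σ
  exact ⟨U, H, hUo, h0U, hH, hHF, hv Θ hΘ hΘc ζ σ U H hUo h0U hH hHF⟩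

end Letter

section Row

variable {L : Type} [Field L] {α : Fin 3 → L} {w : {w : InfinitePlace L // IsComplex w}}

/-- **(ED. 2) N1 = (A6) NAMED ROW ⊕ VALUE THEOREM**: the (L_{U(2,1)}) letter ★ `ArchCentralLimitFormulaRankTwo L α w` from the named print row ★ `ArchCentralLimitCornerRegularity L α w` (p843483,
Harish-Chandra's corner regularity, the EXISTENCE half of N1) and the ∀-extension VALUE THEOREM (`hval`: one `c > 0` per `ν` with `Λ₈^∠[H](0) = −(c·i)·Θ(ζ•1)` for EVERY `C³` corner extension `H` of
`F_Θ∘chart|_{C_σ}` — the ROAD A computation).  One line over `of_cornerRegularity_of_values` (the `def` unfolds to its `hreg` binder verbatim). [cite: Rogawski1990, §8.4 pp. 126–127]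
[cite: HarishChandra1975HARRG1, §17 Lemma 17.5] [cite: Orloff1987OrbitalIntegrals, Introduction p. 198] -/
theorem ArchCentralLimitFormulaRankTwo.of_cornerRegularity (hreg : ArchCentralLimitCornerRegularity L α w)
    (hval : ∀ [MeasurableSpace (archLocal L 3 (Matrix.diagonal α) w)] [BorelSpace (archLocal L 3 (Matrix.diagonal α) w)],
      (∀ i, α i ≠ 0) → (∀ i, (w.1.embedding (α i)).im = 0) →
      (∃ i j : Fin 3, (w.1.embedding (α i)).re * (w.1.embedding (α j)).re < 0) →
      ∀ (ν : MeasureTheory.Measure (archLocal L 3 (Matrix.diagonal α) w)) [ν.IsHaarMeasure] [ν.IsMulRightInvariant],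
      ∃ c : ℝ, 0 < c ∧
        ∀ (Θ : Matrix (Fin 3) (Fin 3) ℂ → ℂ), ContDiff ℝ (⊤ : ℕ∞) Θ →
          HasCompactSupport (fun k : archLocal L 3 (Matrix.diagonal α) w => Θ ((k : GL (Fin 3) ℂ) : Matrix (Fin 3) (Fin 3) ℂ)) →
          ∀ (ζ : Circle) (σ : Equiv.Perm (Fin 3)) (U : Set (Fin 3 → ℝ)) (H : (Fin 3 → ℝ) → ℂ), IsOpen U → (0 : Fin 3 → ℝ) ∈ U → ContDiffOn ℝ 3 H U →
            (∀ θ ∈ U, θ (σ 0) < θ (σ 1) ∧ θ (σ 1) < θ (σ 2) →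
              H θ = ((((ζ * Circle.exp (θ 0) : Circle) : ℂ)) * (((ζ * Circle.exp (θ 2) : Circle) : ℂ))⁻¹) * ((1 - (((ζ * Circle.exp (θ 1) : Circle) : ℂ)) * (((ζ * Circle.exp (θ 0) : Circle) : ℂ))⁻¹) * (1 - (((ζ * Circle.exp (θ 2) : Circle) : ℂ)) * (((ζ * Circle.exp (θ 1) : Circle) : ℂ))⁻¹) * (1 - (((ζ * Circle.exp (θ 2) : Circle) : ℂ)) * (((ζ * Circle.exp (θ 0) : Circle) : ℂ))⁻¹)) * (∫ g, Θ (((g * ⟨circleDiagonal 3 (fun k => ζ * Circle.exp (θ k)), circleDiagonal_mem_archLocal_diagonal L 3 α w _⟩ * g⁻¹ : archLocal L 3 (Matrix.diagonal α) w) : GL (Fin 3) ℂ) : Matrix (Fin 3) (Fin 3) ℂ) ∂ν)) →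
            (1 / 48 : ℂ) * ∑ ε : Fin 3 → Bool, ((((if ε 0 then (1 : ℝ) else -1) * (if ε 1 then (1 : ℝ) else -1) * (if ε 2 then (1 : ℝ) else -1) : ℝ)) : ℂ) *
          iteratedDeriv 3 (fun s : ℝ => H (s • ![(if ε 0 then (1 : ℝ) else -1) + (if ε 1 then (1 : ℝ) else -1), -(if ε 0 then (1 : ℝ) else -1) + (if ε 2 then (1 : ℝ) else -1), -(if ε 1 then (1 : ℝ) else -1) - (if ε 2 then (1 : ℝ) else -1)])) 0 =
              -((c : ℂ) * Complex.I) * Θ ((circleDiagonal 3 (fun _ => ζ) : GL (Fin 3) ℂ) : Matrix (Fin 3) (Fin 3) ℂ)) :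
    ArchCentralLimitFormulaRankTwo L α w :=
  ArchCentralLimitFormulaRankTwo.of_cornerRegularity_of_values hreg hval

end Row

end Literature.NumberTheory.Rogawski1990

end
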